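import Summits.CriticalPhenomena.Ising3DConformalLimit.Theorems.EnergyNotSigmaSquaredGapForcesFarMergingSandwichTailTightnessAux
import Summits.CriticalPhenomena.Ising3DConformalLimit.Theorems.EnergyNotSigmaSquaredGapForcesFarMergingSandwichOnePinchDecayAuxDictionary
import Literature.Probability.LatticeModels.IntersectionSourceSwitch
import HarnessLib

/-!
# Same-point re-rooting of two independent duplicated clusters as a change of measure
# (line `one-cluster-depletion-sandwich` of crux `GapForcesFarMerging`, item stmt-CriticalPhenomena-4468;
# helper file 1 for the registered stub `stub_meetDomination`)

For the four-trace law `fourTraceLaw n y = P^{y₀y₁,∅}_{Λ_n} ⊗ P^{y₂y₃,∅}_{Λ_n}` of the Defs module (two INDEPENDENT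
duplicated clusters `C₁ = C_{n₁+n₂}(y₀)`, `C₂ = C_{n₃+n₄}(y₂)` of the free box `Λ_n ⊂ ℤ³` at `β_c`, read on the pair of
lifted traces) and a vertex `v ∈ Λ_n`, the switching lemma reroutes both pairs of sources through `v` on the event
`{v ∈ C₁ ∩ C₂}` (Aizenman–Duminil-Copin 2021, §4.1, the step
`P^{xy,zt,∅,∅}[u ∈ 𝒯, E] = (⟨σ_uσ_x⟩⟨σ_uσ_y⟩⟨σ_uσ_z⟩⟨σ_uσ_t⟩/⟨σ_xσ_y⟩⟨σ_zσ_t⟩)·P^{ux,uz,uy,ut}[E]`; tree, un-normalised: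
`Current.tsum_prod_connInd_mul_connInd_mul_eq_switch`). This file proves the MEASURE-LEVEL form for the line's objects:

* `reroot_real_boxVertex` / `reroot_real` : for every measurable event `T` of the pair of traces,
  `P[v ∈ C₁(y₀), v ∈ C₂(y₂), T] = ρ_n(y₀,y₁;v) ρ_n(y₂,y₃;v) · (P^{y₁v,y₀v}_{Λ_n} ⊗ P^{y₃v,y₂v}_{Λ_n})[T]`
  with the EXACT one-point densities `ρ_n(a,b;v) = G_n(a,v)G_n(v,b)/G_n(a,b)` (`threePointRatio` of
  `IsingEuclidUpgradeR4NonGaussianDefs`); the re-rooted system is a product of FOUR independent sourced currents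
  `v → y₁`, `y₀ → v`, `v → y₃`, `y₂ → v` read on the two traces `(n₁+n₂)^`, `(n₃+n₄)^`;
* `reroot_restrict` : the same as an identity of measures, `(fourTraceLaw n y)|_{v ∈ C₁ ∩ C₂} = ρρ • P^{rr(v)}`;
* `reroot_compl_null` : the re-rooted law is carried by `{v ∈ C₁(y₀)} × {v ∈ C₂(y₂)}`;
* `tsum_reroot_same_point` : the un-normalised finite-graph identity in the source order `({v}∆{p}, {o}∆{v})`.
Ingredients: the product of two trace laws read on four currents (`prod_sourcedDoubleCurrentLaw_apply`,
`OnePinchDecayProof.prod_doubleCurrentMeasure_apply`), the tree's switching identity, the box dictionary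
`G_n = Z[·]/Z[∅]` (`isingTwoPoint_free_box_eq_toReal_div`). Everything is proved; no definition and no named fact is
introduced. The registered helper is the last theorem `meetDomination_reroot`.

References: M. Aizenman, H. Duminil-Copin, Ann. of Math. 194 (2021) = arXiv:1912.07973, §3.1–3.2, §4.1 (proof of
Thm 1.3, switching step), App. A Prop. A.3 [AizenmanDuminilCopinAnnals2021].
-/

noncomputable section

namespace Summit.CriticalPhenomena.Ising3DConformalLimit.EnergyNotSigmaSquaredGapForcesFarMergingSandwich

namespace MeetDominationProof

open scoped symmDiff ENNReal Topology
open MeasureTheory Filter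
open Literature.Probability.LatticeModels Literature.Probability.Percolation
open Summit.CriticalPhenomena.Ising3DConformalLimit.GapForcesFarMergingSandwich
open Summit.CriticalPhenomena.Ising3DConformalLimit.Cruxes.IsingEuclidUpgradeR4NonGaussian.FreeCovarianceDeltaDichotomy
  (boxG threePointRatio)

/-! ## §1. The un-normalised identity in the line's source order -/

section FiniteGraph

variable {V : Type*} [Fintype V] [DecidableEq V] {Γ : SimpleGraph V} [DecidableRel Γ.Adj] {K : Γ.edgeFinset → ℝ}

/-- **Same-point re-rooting, un-normalised current-sum form** (any finite graph, couplings `K ≥ 0`): for vertices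
`o p a q v` and `Φ ≥ 0` on pairs of summed currents,
`∑ w_{op,∅}(n₁,n₂) w_{aq,∅}(n₃,n₄) 𝟙[v ∈ C_{n₁+n₂}(o)] 𝟙[v ∈ C_{n₃+n₄}(a)] Φ = ∑ w_{vp,ov}(n₁,n₂) w_{vq,av}(n₃,n₄) Φ`
(the tree's `Current.tsum_prod_connInd_mul_connInd_mul_eq_switch`, sources written as `{v}∆{p}`, `{o}∆{v}`).
[cite: AizenmanDuminilCopinAnnals2021, §4.1, proof of Thm 1.3 (switching step)] -/
theorem tsum_reroot_same_point (hK : ∀ e, 0 ≤ K e) (o p a q v : V) (Φ : Current Γ → Current Γ → ℝ≥0∞) :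
    ∑' m : (Current Γ × Current Γ) × (Current Γ × Current Γ),
        epairWeight K ({o} ∆ {p}) ∅ m.1 * epairWeight K ({a} ∆ {q}) ∅ m.2 *
          (Current.connInd v o m.1 * Current.connInd v a m.2 * Φ (m.1.1 + m.1.2) (m.2.1 + m.2.2)) =
      ∑' m : (Current Γ × Current Γ) × (Current Γ × Current Γ),
        epairWeight K ({v} ∆ {p}) ({o} ∆ {v}) m.1 * epairWeight K ({v} ∆ {q}) ({a} ∆ {v}) m.2 *
          Φ (m.1.1 + m.1.2) (m.2.1 + m.2.2) := by
  rw [Current.tsum_prod_connInd_mul_connInd_mul_eq_switch hK o p a q v Φ, symmDiff_comm ({v} : Finset V) {p},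
    symmDiff_comm ({v} : Finset V) {q}]

end FiniteGraph

/-! ## §2. The free box: the product of two sourced trace laws read on four currents -/

/-- The product of two sourced trace laws of the box is the push-forward of the product of the two
double-current measures under the pair of lifted traces (`Measure.map_prod_map`), evaluated on a measurable set.
[cite: AizenmanDuminilCopinAnnals2021, §3.1–3.2] -/
theorem prod_sourcedDoubleCurrentLaw_apply (n : ℕ) (A₁ B₁ A₂ B₂ : Finset (Site 3))
    {S : Set (BondConfig (Site 3) × BondConfig (Site 3))} (hS : MeasurableSet S) :
    ((sourcedDoubleCurrentLaw 3 n βc A₁ B₁).prod (sourcedDoubleCurrentLaw 3 n βc A₂ B₂)) S =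
      ((doubleCurrentMeasure (freeBoxGraph 3 n) βc (boxSources 3 n A₁) (boxSources 3 n B₁)).prod
        (doubleCurrentMeasure (freeBoxGraph 3 n) βc (boxSources 3 n A₂) (boxSources 3 n B₂)))
        (Prod.map (sourcedTrace 3 n) (sourcedTrace 3 n) ⁻¹' S) := by
  haveI : ∀ A B : Finset (BoxVertex 3 n), SFinite (doubleCurrentMeasure (freeBoxGraph 3 n) βc A B) := fun A B => by
    unfold doubleCurrentMeasure; infer_instance
  rw [sourcedDoubleCurrentLaw, sourcedDoubleCurrentLaw,
    Measure.map_prod_map _ _ (measurable_sourcedTrace n) (measurable_sourcedTrace n),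
    Measure.map_apply ((measurable_sourcedTrace n).prodMap (measurable_sourcedTrace n)) hS]


/-! ## §3. Exact same-point re-rooting at the measure level -/

/-- **Same-point re-rooting as a change of measure** (Aizenman–Duminil-Copin 2021, §4.1, the switching step, for the
product of two sourced duplicated clusters of the free box `Λ_n ⊂ ℤ³` at `β_c`): for box vertices `a, b, c, e, v ∈ Λ_n`
and every measurable event `T` of the pair of traces,
`P^{ab,∅}⊗P^{ce,∅}[v ∈ C₁(a), v ∈ C₂(c), T] = ρ_n(a,b;v) ρ_n(c,e;v) · P^{bv,av}⊗P^{ev,cv}[T]`,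
`ρ_n(a,b;v) = G_n(a,v)G_n(v,b)/G_n(a,b)` (`threePointRatio`): on `{v ∈ C₁ ∩ C₂}` the sources are rerouted through `v`,
and the re-rooted system is a product of FOUR independent sourced currents `∂ = {b,v}, {a,v}, {e,v}, {c,v}` read on the
two traces. [cite: AizenmanDuminilCopinAnnals2021, §4.1, proof of Thm 1.3 (switching step)] -/
theorem reroot_real_boxVertex {n : ℕ} (a b c e v : BoxVertex 3 n) (ha : (a : Site 3) ∈ box 3 n)
    (hb : (b : Site 3) ∈ box 3 n) (hc : (c : Site 3) ∈ box 3 n) (he : (e : Site 3) ∈ box 3 n)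
    (hv : (v : Site 3) ∈ box 3 n) {T : Set (BondConfig (Site 3) × BondConfig (Site 3))}
    (hT : MeasurableSet T) :
    ((sourcedDoubleCurrentLaw 3 n βc ({(a : Site 3)} ∆ {(b : Site 3)}) ∅).prod
        (sourcedDoubleCurrentLaw 3 n βc ({(c : Site 3)} ∆ {(e : Site 3)}) ∅)).real
        ({ω | ω.1 ∈ openConn (a : Site 3) (v : Site 3) ∧ ω.2 ∈ openConn (c : Site 3) (v : Site 3)} ∩ T) =
      threePointRatio n a b v * threePointRatio n c e v *
        ((sourcedDoubleCurrentLaw 3 n βc ({(b : Site 3)} ∆ {(v : Site 3)}) ({(a : Site 3)} ∆ {(v : Site 3)})).prod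
          (sourcedDoubleCurrentLaw 3 n βc ({(e : Site 3)} ∆ {(v : Site 3)}) ({(c : Site 3)} ∆ {(v : Site 3)}))).real
          T := by
  have hβ : 0 ≤ βc := criticalBeta_nonneg 3
  have hK : ∀ e', 0 ≤ (fun _ : (freeBoxGraph 3 n).edgeFinset => βc) e' := fun _ => hβ
  have hZtop : ∀ S, ecurrentSum (fun _ : (freeBoxGraph 3 n).edgeFinset => βc) S ≠ ∞ := fun S =>
    ecurrentSum_ne_top hK S
  have hZne : ∀ S, currentSum (freeBoxGraph 3 n) βc S ≠ 0 →
      ecurrentSum (fun _ : (freeBoxGraph 3 n).edgeFinset => βc) S ≠ 0 := fun S hS h => hS (by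
    rw [currentSum_eq_wcurrentSum, ← toReal_ecurrentSum hK, h, ENNReal.toReal_zero])
  have hr : ∀ S, currentSum (freeBoxGraph 3 n) βc S ≠ 0 →
      0 < (ecurrentSum (fun _ : (freeBoxGraph 3 n).edgeFinset => βc) S).toReal := fun S hS =>
    ENNReal.toReal_pos (hZne S hS) (hZtop S)
  -- nondegeneracy of the normalisers
  have h0 := OnePinchDecayProof.currentSum_empty_ne_zero n
  have hab := OnePinchDecayProof.currentSum_pair_ne_zero a b ha hb
  have hce := OnePinchDecayProof.currentSum_pair_ne_zero c e hc he
  have hbv := OnePinchDecayProof.currentSum_pair_ne_zero b v hb hv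
  have hav := OnePinchDecayProof.currentSum_pair_ne_zero a v ha hv
  have hev := OnePinchDecayProof.currentSum_pair_ne_zero e v he hv
  have hcv := OnePinchDecayProof.currentSum_pair_ne_zero c v hc hv
  -- the event read on the four currents
  set F : Set (BondConfig (Site 3) × BondConfig (Site 3)) :=
    {ω | ω.1 ∈ openConn (a : Site 3) (v : Site 3) ∧ ω.2 ∈ openConn (c : Site 3) (v : Site 3)} with hFdef
  have hFmeas : MeasurableSet F :=
    (measurableSet_openConn_holds (a : Site 3) (v : Site 3)).prod (measurableSet_openConn_holds (c : Site 3) (v : Site 3))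
  set Φ : Current (freeBoxGraph 3 n) → Current (freeBoxGraph 3 n) → ℝ≥0∞ := fun m m' =>
    T.indicator 1 (liftBonds 3 n m.traced, liftBonds 3 n m'.traced) with hΦdef
  have hpreT : ∀ pq : (Current (freeBoxGraph 3 n) × Current (freeBoxGraph 3 n)) ×
      (Current (freeBoxGraph 3 n) × Current (freeBoxGraph 3 n)),
      (Prod.map (sourcedTrace 3 n) (sourcedTrace 3 n) ⁻¹' T).indicator
        (1 : (Current (freeBoxGraph 3 n) × Current (freeBoxGraph 3 n)) ×
          (Current (freeBoxGraph 3 n) × Current (freeBoxGraph 3 n)) → ℝ≥0∞) pq =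
        Φ (pq.1.1 + pq.1.2) (pq.2.1 + pq.2.2) := fun pq => rfl
  have hconn : ∀ (x : BoxVertex 3 n) (p : Current (freeBoxGraph 3 n) × Current (freeBoxGraph 3 n)),
      sourcedTrace 3 n p ∈ (openConn (x : Site 3) (v : Site 3) : Set (BondConfig (Site 3))) ↔
        v ∈ (p.1 + p.2).cluster x := fun x p => by
    rw [Current.mem_cluster_iff, ← mem_tracedConn_iff, ← sourcedTrace_preimage_openConn 3 x v, Set.mem_preimage]
  have hpre : ∀ pq : (Current (freeBoxGraph 3 n) × Current (freeBoxGraph 3 n)) ×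
      (Current (freeBoxGraph 3 n) × Current (freeBoxGraph 3 n)),
      (Prod.map (sourcedTrace 3 n) (sourcedTrace 3 n) ⁻¹' (F ∩ T)).indicator
        (1 : (Current (freeBoxGraph 3 n) × Current (freeBoxGraph 3 n)) ×
          (Current (freeBoxGraph 3 n) × Current (freeBoxGraph 3 n)) → ℝ≥0∞) pq =
        Current.connInd v a pq.1 * Current.connInd v c pq.2 * Φ (pq.1.1 + pq.1.2) (pq.2.1 + pq.2.2) := by
    intro pq
    rw [← hpreT pq]
    unfold Current.connInd
    by_cases h1 : v ∈ (pq.1.1 + pq.1.2).cluster a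
    · by_cases h2 : v ∈ (pq.2.1 + pq.2.2).cluster c
      · have hF : Prod.map (sourcedTrace 3 n) (sourcedTrace 3 n) pq ∈ F := ⟨(hconn a pq.1).2 h1, (hconn c pq.2).2 h2⟩
        rw [if_pos h1, if_pos h2, one_mul, one_mul]
        by_cases h3 : Prod.map (sourcedTrace 3 n) (sourcedTrace 3 n) pq ∈ T
        · rw [Set.indicator_of_mem (show pq ∈ _ ⁻¹' (F ∩ T) from ⟨hF, h3⟩),
            Set.indicator_of_mem (show pq ∈ _ ⁻¹' T from h3)]
        · rw [Set.indicator_of_notMem (fun h : pq ∈ _ ⁻¹' (F ∩ T) => h3 h.2),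
            Set.indicator_of_notMem (fun h : pq ∈ _ ⁻¹' T => h3 h)]
      · rw [if_neg h2, mul_zero, zero_mul,
          Set.indicator_of_notMem (fun h : pq ∈ _ ⁻¹' (F ∩ T) => h2 ((hconn c pq.2).1 h.1.2))]
    · rw [if_neg h1, zero_mul, zero_mul,
        Set.indicator_of_notMem (fun h : pq ∈ _ ⁻¹' (F ∩ T) => h1 ((hconn a pq.1).1 h.1.1))]
  -- the switched four-current sum `X = ∑ W^{rr(v)} Φ`
  set X : ℝ≥0∞ := ∑' pq : (Current (freeBoxGraph 3 n) × Current (freeBoxGraph 3 n)) ×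
      (Current (freeBoxGraph 3 n) × Current (freeBoxGraph 3 n)),
      epairWeight (fun _ : (freeBoxGraph 3 n).edgeFinset => βc) ({b} ∆ {v}) ({a} ∆ {v}) pq.1 *
        epairWeight (fun _ : (freeBoxGraph 3 n).edgeFinset => βc) ({e} ∆ {v}) ({c} ∆ {v}) pq.2 *
        Φ (pq.1.1 + pq.1.2) (pq.2.1 + pq.2.2) with hXdef
  have hsumL : ∑' pq : (Current (freeBoxGraph 3 n) × Current (freeBoxGraph 3 n)) ×
      (Current (freeBoxGraph 3 n) × Current (freeBoxGraph 3 n)),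
      epairWeight (fun _ : (freeBoxGraph 3 n).edgeFinset => βc) ({a} ∆ {b}) ∅ pq.1 *
        epairWeight (fun _ : (freeBoxGraph 3 n).edgeFinset => βc) ({c} ∆ {e}) ∅ pq.2 *
        (Prod.map (sourcedTrace 3 n) (sourcedTrace 3 n) ⁻¹' (F ∩ T)).indicator 1 pq = X := by
    rw [hXdef, ← Current.tsum_prod_connInd_mul_connInd_mul_eq_switch hK a b c e v Φ]
    exact tsum_congr fun pq => by rw [hpre pq, mul_assoc]
  have hsumR : ∑' pq : (Current (freeBoxGraph 3 n) × Current (freeBoxGraph 3 n)) ×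
      (Current (freeBoxGraph 3 n) × Current (freeBoxGraph 3 n)),
      epairWeight (fun _ : (freeBoxGraph 3 n).edgeFinset => βc) ({b} ∆ {v}) ({a} ∆ {v}) pq.1 *
        epairWeight (fun _ : (freeBoxGraph 3 n).edgeFinset => βc) ({e} ∆ {v}) ({c} ∆ {v}) pq.2 *
        (Prod.map (sourcedTrace 3 n) (sourcedTrace 3 n) ⁻¹' T).indicator 1 pq = X :=
    tsum_congr fun pq => by rw [hpreT pq]
  have hL : ((sourcedDoubleCurrentLaw 3 n βc ({(a : Site 3)} ∆ {(b : Site 3)}) ∅).prod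
      (sourcedDoubleCurrentLaw 3 n βc ({(c : Site 3)} ∆ {(e : Site 3)}) ∅)) (F ∩ T) =
      X / (ecurrentSum (fun _ : (freeBoxGraph 3 n).edgeFinset => βc) ({a} ∆ {b}) *
        ecurrentSum (fun _ : (freeBoxGraph 3 n).edgeFinset => βc) ∅ *
        (ecurrentSum (fun _ : (freeBoxGraph 3 n).edgeFinset => βc) ({c} ∆ {e}) *
          ecurrentSum (fun _ : (freeBoxGraph 3 n).edgeFinset => βc) ∅)) := by
    rw [prod_sourcedDoubleCurrentLaw_apply n _ _ _ _ (hFmeas.inter hT), boxSources_pair, boxSources_pair,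
      boxSources_empty, OnePinchDecayProof.prod_doubleCurrentMeasure_apply _ hβ hab h0 hce h0, hsumL]
  have hR : ((sourcedDoubleCurrentLaw 3 n βc ({(b : Site 3)} ∆ {(v : Site 3)}) ({(a : Site 3)} ∆ {(v : Site 3)})).prod
      (sourcedDoubleCurrentLaw 3 n βc ({(e : Site 3)} ∆ {(v : Site 3)}) ({(c : Site 3)} ∆ {(v : Site 3)}))) T =
      X / (ecurrentSum (fun _ : (freeBoxGraph 3 n).edgeFinset => βc) ({b} ∆ {v}) *
        ecurrentSum (fun _ : (freeBoxGraph 3 n).edgeFinset => βc) ({a} ∆ {v}) *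
        (ecurrentSum (fun _ : (freeBoxGraph 3 n).edgeFinset => βc) ({e} ∆ {v}) *
          ecurrentSum (fun _ : (freeBoxGraph 3 n).edgeFinset => βc) ({c} ∆ {v}))) := by
    rw [prod_sourcedDoubleCurrentLaw_apply n _ _ _ _ hT, boxSources_pair, boxSources_pair, boxSources_pair,
      boxSources_pair, OnePinchDecayProof.prod_doubleCurrentMeasure_apply _ hβ hbv hav hev hcv, hsumR]
  -- finiteness of `X`
  have hXle : X ≤ ecurrentSum (fun _ : (freeBoxGraph 3 n).edgeFinset => βc) ({b} ∆ {v}) *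
      ecurrentSum (fun _ : (freeBoxGraph 3 n).edgeFinset => βc) ({a} ∆ {v}) *
      (ecurrentSum (fun _ : (freeBoxGraph 3 n).edgeFinset => βc) ({e} ∆ {v}) *
        ecurrentSum (fun _ : (freeBoxGraph 3 n).edgeFinset => βc) ({c} ∆ {v})) := by
    rw [← tsum_epairWeight, ← tsum_epairWeight, tsum_mul_tsum_eq_tsum_prod]
    exact ENNReal.tsum_le_tsum fun pq => mul_le_of_le_one_right' (Set.indicator_le_self _ _ _)
  have hXtop : X ≠ ∞ := ne_top_of_le_ne_top
    (ENNReal.mul_ne_top (ENNReal.mul_ne_top (hZtop _) (hZtop _)) (ENNReal.mul_ne_top (hZtop _) (hZtop _))) hXle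
  -- the box two-point functions as ratios of current sums
  have hG : ∀ x z : BoxVertex 3 n, (x : Site 3) ∈ box 3 n → (z : Site 3) ∈ box 3 n →
      boxG n x z = (ecurrentSum (fun _ : (freeBoxGraph 3 n).edgeFinset => βc) ({x} ∆ {z})).toReal /
        (ecurrentSum (fun _ : (freeBoxGraph 3 n).edgeFinset => βc) ∅).toReal :=
    fun x z hx hz => isingTwoPoint_free_box_eq_toReal_div n hβ x z hx hz
  -- assemble in `ℝ`
  rw [measureReal_def, hL, measureReal_def, hR, ENNReal.toReal_div, ENNReal.toReal_div]
  simp only [ENNReal.toReal_mul]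
  rw [threePointRatio, threePointRatio, hG a v ha hv, hG v b hv hb, hG a b ha hb, hG c v hc hv, hG v e hv he,
    hG c e hc he, symmDiff_comm ({v} : Finset (BoxVertex 3 n)) {b}, symmDiff_comm ({v} : Finset (BoxVertex 3 n)) {e}]
  have := hr _ h0; have := hr _ hab; have := hr _ hce; have := hr _ hbv; have := hr _ hav; have := hr _ hev
  have := hr _ hcv
  field_simp

/-! ## §4. The four-trace law of a quadruple: change of measure and support -/

/-- For `a, b, c, d ∈ Λ_n` the sourced box law `P^{ab,cd}_{Λ_n,β_c}` is a probability measure. [folklore] -/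
theorem isProbabilityMeasure_law₂ {n : ℕ} {a b c d : Site 3} (ha : a ∈ box 3 n) (hb : b ∈ box 3 n)
    (hc : c ∈ box 3 n) (hd : d ∈ box 3 n) :
    IsProbabilityMeasure (sourcedDoubleCurrentLaw 3 n βc ({a} ∆ {b}) ({c} ∆ {d})) := by
  have hβ : 0 < βc := criticalBeta_pos_holds (d := 3) (by norm_num)
  have hsub : ∀ {x z : Site 3}, x ∈ box 3 n → z ∈ box 3 n → ({x} ∆ {z} : Finset (Site 3)) ⊆ box 3 n :=
    fun hx hz w hw => by
      rcases Finset.mem_symmDiff.1 hw with ⟨h, -⟩ | ⟨h, -⟩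
      · rw [Finset.mem_singleton.1 h]; exact hx
      · rw [Finset.mem_singleton.1 h]; exact hz
  exact isProbabilityMeasure_sourcedDoubleCurrentLaw hβ.le
    (currentSum_boxSources_pos 3 hβ (hsub ha hb) (TailTightnessProof.even_card_pair_symmDiff a b)).ne'
    (currentSum_boxSources_pos 3 hβ (hsub hc hd) (TailTightnessProof.even_card_pair_symmDiff c d)).ne'

/-- The exact one-point density is positive inside the box: `ρ_n(a,b;v) > 0` for `a, b, v ∈ Λ_n` (`β_c > 0`). [folklore] -/
theorem threePointRatio_pos {n : ℕ} {a b v : Site 3} (ha : a ∈ box 3 n) (hb : b ∈ box 3 n) (hv : v ∈ box 3 n) :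
    0 < threePointRatio n a b v := by
  have hl : ∀ x ∈ box 3 n, ∃ x' : BoxVertex 3 n, (x' : Site 3) = x := fun x hx =>
    ⟨⟨x, box_subset_box_succ 3 n hx⟩, rfl⟩
  obtain ⟨⟨a, rfl⟩, ⟨b, rfl⟩, ⟨v, rfl⟩⟩ := And.intro (hl a ha) (And.intro (hl b hb) (hl v hv))
  have hβ : 0 ≤ βc := criticalBeta_nonneg 3
  have hK : ∀ e', 0 ≤ (fun _ : (freeBoxGraph 3 n).edgeFinset => βc) e' := fun _ => hβ
  have hpos : ∀ x z : BoxVertex 3 n, (x : Site 3) ∈ box 3 n → (z : Site 3) ∈ box 3 n → 0 < boxG n x z := by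
    intro x z hx hz
    have hr : ∀ S, currentSum (freeBoxGraph 3 n) βc S ≠ 0 →
        0 < (ecurrentSum (fun _ : (freeBoxGraph 3 n).edgeFinset => βc) S).toReal := fun S hS =>
      ENNReal.toReal_pos (fun h => hS (by rw [currentSum_eq_wcurrentSum, ← toReal_ecurrentSum hK, h,
        ENNReal.toReal_zero])) (ecurrentSum_ne_top hK S)
    rw [show boxG n x z = _ from isingTwoPoint_free_box_eq_toReal_div n hβ x z hx hz]
    exact div_pos (hr _ (OnePinchDecayProof.currentSum_pair_ne_zero x z hx hz)) (hr _ (OnePinchDecayProof.currentSum_empty_ne_zero n))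
  exact div_pos (mul_pos (hpos a v ha hv) (hpos v b hv hb)) (hpos a b ha hb)

/-- **Same-point re-rooting for the four-trace law of a quadruple `y ⊂ Λ_n`** (real form): for `v ∈ Λ_n` and measurable `T`,
`P[v ∈ C₁(y₀), v ∈ C₂(y₂), T] = ρ_n(y₀,y₁;v) ρ_n(y₂,y₃;v) · P^{y₁v, y₀v} ⊗ P^{y₃v, y₂v}[T]`.
[cite: AizenmanDuminilCopinAnnals2021, §4.1, proof of Thm 1.3 (switching step)] -/
theorem reroot_real {n : ℕ} {y : Fin 4 → Site 3} (hy : ∀ i, y i ∈ box 3 n) {v : Site 3} (hv : v ∈ box 3 n)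
    {T : Set (BondConfig (Site 3) × BondConfig (Site 3))} (hT : MeasurableSet T) :
    (fourTraceLaw n y).real ({ω | ω.1 ∈ openConn (y 0) v ∧ ω.2 ∈ openConn (y 2) v} ∩ T) =
      threePointRatio n (y 0) (y 1) v * threePointRatio n (y 2) (y 3) v *
        ((sourcedDoubleCurrentLaw 3 n βc ({y 1} ∆ {v}) ({y 0} ∆ {v})).prod
          (sourcedDoubleCurrentLaw 3 n βc ({y 3} ∆ {v}) ({y 2} ∆ {v}))).real T := by
  have hl : ∀ x ∈ box 3 n, ∃ x' : BoxVertex 3 n, (x' : Site 3) = x := fun x hx =>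
    ⟨⟨x, box_subset_box_succ 3 n hx⟩, rfl⟩
  obtain ⟨a, ha⟩ := hl _ (hy 0)
  obtain ⟨b, hb⟩ := hl _ (hy 1)
  obtain ⟨c, hc⟩ := hl _ (hy 2)
  obtain ⟨e, he⟩ := hl _ (hy 3)
  obtain ⟨v, rfl⟩ := hl v hv
  have ha' := hy 0; have hb' := hy 1; have hc' := hy 2; have he' := hy 3
  rw [← ha] at ha'; rw [← hb] at hb'; rw [← hc] at hc'; rw [← he] at he'
  rw [fourTraceLaw, ← ha, ← hb, ← hc, ← he]
  exact reroot_real_boxVertex a b c e v ha' hb' hc' he' hv hT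

/-- **Same-point re-rooting as an identity of measures**: restricted to `{v ∈ C₁(y₀)} × {v ∈ C₂(y₂)}`, the four-trace
law of `y` IS `ρ_n(y₀,y₁;v)ρ_n(y₂,y₃;v)` times the re-rooted law `P^{y₁v, y₀v} ⊗ P^{y₃v, y₂v}`.
[cite: AizenmanDuminilCopinAnnals2021, §4.1, proof of Thm 1.3 (switching step)] -/
theorem reroot_restrict {n : ℕ} {y : Fin 4 → Site 3} (hy : ∀ i, y i ∈ box 3 n) {v : Site 3} (hv : v ∈ box 3 n) :
    (fourTraceLaw n y).restrict {ω | ω.1 ∈ openConn (y 0) v ∧ ω.2 ∈ openConn (y 2) v} =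
      ENNReal.ofReal (threePointRatio n (y 0) (y 1) v * threePointRatio n (y 2) (y 3) v) •
        ((sourcedDoubleCurrentLaw 3 n βc ({y 1} ∆ {v}) ({y 0} ∆ {v})).prod
          (sourcedDoubleCurrentLaw 3 n βc ({y 3} ∆ {v}) ({y 2} ∆ {v}))) := by
  haveI : IsProbabilityMeasure (fourTraceLaw n y) := TailTightnessProof.isProbabilityMeasure_fourTraceLaw hy
  haveI := isProbabilityMeasure_law₂ (hy 1) hv (hy 0) hv
  haveI := isProbabilityMeasure_law₂ (hy 3) hv (hy 2) hv
  refine Measure.ext fun T hT => ?_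
  rw [Measure.restrict_apply hT, Set.inter_comm, Measure.smul_apply, smul_eq_mul, ← ofReal_measureReal (measure_ne_top _ _),
    reroot_real hy hv hT, ENNReal.ofReal_mul (mul_pos (threePointRatio_pos (hy 0) (hy 1) hv)
      (threePointRatio_pos (hy 2) (hy 3) hv)).le, ofReal_measureReal (measure_ne_top _ _)]

/-- **Support of the re-rooted law**: under `P^{y₁v, y₀v} ⊗ P^{y₃v, y₂v}` the vertex `v` lies in both clusters
`C₁(y₀)`, `C₂(y₂)` almost surely (the sources `{y₀,v}`, `{y₂,v}` of the second currents join them). [folklore] -/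
theorem reroot_compl_null {n : ℕ} {y : Fin 4 → Site 3} (hy : ∀ i, y i ∈ box 3 n) {v : Site 3} (hv : v ∈ box 3 n) :
    ((sourcedDoubleCurrentLaw 3 n βc ({y 1} ∆ {v}) ({y 0} ∆ {v})).prod
        (sourcedDoubleCurrentLaw 3 n βc ({y 3} ∆ {v}) ({y 2} ∆ {v})))
      {ω | ω.1 ∈ openConn (y 0) v ∧ ω.2 ∈ openConn (y 2) v}ᶜ = 0 := by
  haveI := isProbabilityMeasure_law₂ (hy 1) hv (hy 0) hv
  haveI := isProbabilityMeasure_law₂ (hy 3) hv (hy 2) hv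
  have hF : MeasurableSet {ω : BondConfig (Site 3) × BondConfig (Site 3) | ω.1 ∈ openConn (y 0) v ∧ ω.2 ∈ openConn (y 2) v} :=
    (measurableSet_openConn_holds (y 0) v).prod (measurableSet_openConn_holds (y 2) v)
  have h := reroot_real hy hv hF.compl
  rw [Set.inter_compl_self, measureReal_empty, eq_comm, mul_eq_zero] at h
  rcases h with h | h
  · exact absurd h (mul_pos (threePointRatio_pos (hy 0) (hy 1) hv) (threePointRatio_pos (hy 2) (hy 3) hv)).ne'
  · exact (measureReal_eq_zero_iff (measure_ne_top _ _)).1 h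

end MeetDominationProof

open MeasureTheory Filter
open scoped symmDiff
open Literature.Probability.LatticeModels Literature.Probability.Percolation
open Summit.CriticalPhenomena.Ising3DConformalLimit.GapForcesFarMergingSandwich
open Summit.CriticalPhenomena.Ising3DConformalLimit.Cruxes.IsingEuclidUpgradeR4NonGaussian.FreeCovarianceDeltaDichotomy
  (threePointRatio)

/-- **Registered helper `meetDomination_reroot`** (same-point re-rooting as a change of measure, helper for
`stub_meetDomination`): for a quadruple `y ⊂ Λ_n`, a vertex `v ∈ Λ_n` and a measurable event `T` of the pair of traces,
`P^{y₀y₁,∅}⊗P^{y₂y₃,∅}_{Λ_n}[v ∈ C₁(y₀), v ∈ C₂(y₂), T] = ρ_n(y₀,y₁;v) ρ_n(y₂,y₃;v) · P^{y₁v,y₀v}⊗P^{y₃v,y₂v}_{Λ_n}[T]`,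
`ρ_n(a,b;v) = G_n(a,v)G_n(v,b)/G_n(a,b)`. [cite: AizenmanDuminilCopinAnnals2021, §4.1, proof of Thm 1.3 (switching step)] -/
theorem meetDomination_reroot : ∀ (n : ℕ) (y : Fin 4 → Site 3), (∀ i, y i ∈ box 3 n) → ∀ v ∈ box 3 n, ∀ T : Set (BondConfig (Site 3) × BondConfig (Site 3)), MeasurableSet T → (fourTraceLaw n y).real ({ω | ω.1 ∈ openConn (y 0) v ∧ ω.2 ∈ openConn (y 2) v} ∩ T) = threePointRatio n (y 0) (y 1) v * threePointRatio n (y 2) (y 3) v * ((sourcedDoubleCurrentLaw 3 n βc ({y 1} ∆ {v}) ({y 0} ∆ {v})).prod (sourcedDoubleCurrentLaw 3 n βc ({y 3} ∆ {v}) ({y 2} ∆ {v}))).real T :=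
  fun _ _ hy _ hv _ hT => MeetDominationProof.reroot_real hy hv hT

end Summit.CriticalPhenomena.Ising3DConformalLimit.EnergyNotSigmaSquaredGapForcesFarMergingSandwich

end
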